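import Literature.NumberTheory.LFunctions.BondarenkoHeap2026Section6Reduction
import HarnessLib

/-!
# Bondarenko–Heap 2026, §6.2: the weight/scale interface RE-TYPED with a loss `q^{ε}` PER
# DERIVATIVE (correction block E-ah-3 / GAP G-ah-9 of the cell `rh-crit`, corpus C5)

Topic `Literature/NumberTheory/LFunctions`, namespace
`Literature.NumberTheory.LFunctions.BondarenkoHeap2026`. STATEMENT LAYER (primed copies of the §6
interface of `BondarenkoHeap2026Section6.lean`; the audited originals are untouched), RH-FREE.

**Why.** [BondarenkoHeap2026, §6.2, TeX l.834–836] describes the weights produced by the Mellin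
separation of variables as "complex valued 1-bounded smooth functions supported on `[K,2K]`,
`[M,2M]`, `[R,2R]`, respectively, whose `j`th order derivatives are `≪ q^ε`. Strictly speaking, the
`q^ε` out front should be a normalisation factor `‖a,b,c‖_∞`, which happens to satisfy the bound
`≪ q^ε`, however in the interests of brevity we write things in this simpler way. We finally remark
that on writing `log k = log K + log(k/K)` we may express `a_k = V(k/K)` for some smooth function
`V(x)` supported on `[1,2]` satisfying the bounds `‖V^{(j)}‖_∞ ≪ q^ε`." The paper's own example two
sentences earlier (l.826): "e.g. differentiating `(K/x)^{s₁}` with respect to `x` gives a factor of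
`−s₁` which is then `≪ q^ε`" — so the `j`-th derivative of the separated weight
`x ↦ ω(x/K)(K/x)^{s₁}`, `s₁ = ε + it`, `|t| ≤ q^ε`, carries `|s₁(s₁+1)⋯(s₁+j−1)| ≍ q^{jε}`: the loss
is `q^ε` PER DERIVATIVE TAKEN, `(q^ε)^j` at order `j`, not one `q^ε` for all orders. The tree's
`IsSmoothDyadicWeight X A Q a` (Section6.lean:85, `‖a^{(j)}(x)‖ ≤ A_j · Q / X^j` for all `j` with ONE
`Q = q^{ε₁}`, the family `A` fixed before `ε₁` in `CorrSumBoundOn`) is faithful to the letter of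
l.834–836 but no separation of variables delivers its members (cell records: t3 g2 memo
`ah/MEMO-t3-offDiagReduction.md` §2, referee ruling G-t3-1, lead R-g5-22/23/25), so the named fact
`offDiag_reduction` cannot be discharged along its own hypothesis by the printed §6.2. This file
re-types the interface as the printed ARGUMENT uses it:

* `IsSmoothDyadicWeight' X A Q a` — as before but `‖a^{(j)}(x)‖ ≤ A_j · Q^j / X^j` (all `j`);
* `IsAdmissibleScale' q δ C₀ K M R` — `1/2 ≤ K, M, R` (was `1 ≤`): a smooth partition of unity
  `∑_X ω(x/X)² = 1` needs open overlapping supports, so with the window `X ≤ x ≤ 2X` the integer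
  `x = X` is never inside a piece and the slices `m = 1`, `r = 1` require a piece of scale in
  `[1/2, 1)` (the tree's constructed partition `SmoothDyadicPartition.lean` uses scales `√2^j`,
  lowest piece `X = 1/√2`; the printed "supported on `[1,2]`, `X = 2^j` say", l.751, is loose —
  G-ah-9b); the two printed inequalities `R ≪ KM/T`, `KM ≪ L` are unchanged;
* `CorrSumBoundOn'`, `CorrSumPowerSaving'`, `rangeI'_bound`, `rangeII'_bound`, `rangeIII'_bound`,
  `lemma10'` (V-clause `‖V^{(j)}‖ ≤ A_j (q^{ε₁})^j`), `offDiag_reduction'` — VERBATIM copies of the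
  unprimed statements over the primed classes (quantifier order `∀ C₀ ∀ A ∃ ε₁ ∃ C` KEPT);
* PROVED glue: `IsSmoothDyadicWeight'.mono`, `IsSmoothDyadicWeight.toPrimed` (the unprimed class
  is contained in the primed one for `Q ≥ 1` PROVIDED `A 0 ≥ 1` — at `j = 0` the primed bound reads
  `‖a‖ ≤ A_0` instead of `‖a‖ ≤ A_0 Q`, the one place where priming tightens; the separate clause
  `‖a‖ ≤ 1` makes `A 0 ≥ 1` harmless), `IsAdmissibleScale.toPrimed`, `CorrSumBoundOn'.toUnprimed`
  (a primed range bound IMPLIES the unprimed one: the primed facts are the STRONGER statements),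
  hence `rangeI_bound_of_primed` etc. and `offDiag_reduction'_of_unprimed`
  (`offDiag_reduction → offDiag_reduction'`: the primed reduction is the WEAKER statement — the one
  §6.2 proves); `corrSumPowerSaving'_of_ranges'` and `prop6_of_reduction'_of_ranges'` (textual
  copies of `corrSumPowerSaving_of_ranges`, `prop6_of_reduction_of_ranges`).

Provability notes for the successors who re-prove the ranges over the primed interface
(refactor-then-corollary, R-g5-22 (3)): the landed range proofs use the derivative clause only for
`j ≤ 1` (`bvNorm b ≤ 1 + A 1 · Q`, Section6Proofs:1156) and, through `lemma10`, `j = 2`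
(PrimeSumsProofs `hAV 2`, loss `(q^{ε₁})²`: take `ε₁/2`); they use `1 ≤ K` in
`sum_norm_weight_vonMangoldt_le`, `natLog_two_floor_add_one_le`, Lemma 8, and `1 ≤ R ≤ M` in
Lemmas 7, 9 (Section6Proofs:376, 849, 1255). Under `IsAdmissibleScale'`: `K < 1` is VACUOUS (the
`k`-box is `{1}` and `Λ(1) = 0`, so `corrSumE = 0`); `R < 1` or `M < 1` forces the box `{1}` in that
variable, where Lemmas 7/9 apply after replacing the scale by `max R 1` / `max M 1` (the window
`[1,2]` contains `1`), at the cost of absolute constants. Nothing here bears on the truth of RH.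

## References

* [BondarenkoHeap2026] arXiv:2608.07399v1, §6.2 (TeX l.742–847: l.751 partition, l.766 scales,
  l.826 example, l.834–836 weights, l.838–847 power saving), (23) l.873, (27) l.991, (40) l.1304,
  Lemma 10 l.1108–1123, §6.5 l.1309, Proposition 6 l.644–648.
-/

noncomputable section

open scoped ContDiff ArithmeticFunction.vonMangoldt
open Finset

namespace Literature.NumberTheory.LFunctions.BondarenkoHeap2026

/-! ### The primed weight class and admissible scales -/

/-- **Smooth dyadic weight at scale `X`, loss `Q` PER DERIVATIVE** ("complex valued 1-bounded smooth
functions supported on `[K,2K]` … whose `j`th order derivatives are `≪ q^ε`", TeX l.834–836, read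
as the §6.2 argument uses it — "differentiating `(K/x)^{s₁}` with respect to `x` gives a factor of
`−s₁` which is then `≪ q^ε`", l.826, so order `j` carries `≍ q^{jε}`): `a` is `C^∞`, vanishes off
`[X, 2X]`, `‖a x‖ ≤ 1`, and `‖a^{(j)}(x)‖ ≤ A_j · Q^j / X^j` for every `j`, `x`. The Mellin-separated
weights `ω(x/X)(X/x)^{ε+it}`, `|t| ≤ q^ε`, belong to it with `A_j = c_j(ω) 2^j`, `Q = q^ε`.
(Primed copy of `IsSmoothDyadicWeight`, which has `A_j · Q / X^j`.)
[cite: BondarenkoHeap2026, §6.2, TeX l.826 and l.834–836] -/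
def IsSmoothDyadicWeight' (X : ℝ) (A : ℕ → ℝ) (Q : ℝ) (a : ℝ → ℂ) : Prop :=
  ContDiff ℝ ∞ a ∧ (∀ x : ℝ, a x ≠ 0 → X ≤ x ∧ x ≤ 2 * X) ∧ (∀ x : ℝ, ‖a x‖ ≤ 1) ∧
    ∀ (j : ℕ) (x : ℝ), ‖iteratedDeriv j a x‖ ≤ A j * Q ^ j / X ^ j

/-- **Admissible scales, pieces down to `1/2`** (l.766 "`R ≪ KM/T`, `KM ≪ L`" unchanged; the lower
bounds `1 ≤ K, M, R` of `IsAdmissibleScale` relaxed to `1/2 ≤ K, M, R`: a smooth partition of unity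
with window `X ≤ x ≤ 2X` never contains the integer `X` inside a piece, so `m = 1`, `r = 1` live in
a piece of scale in `[1/2, 1)` — l.751 "supported on `[1,2]` … `2^j` say" is loose, cf. the tree's
`SmoothDyadicPartition.lean` with scales `√2^j`). [cite: BondarenkoHeap2026, §6.2, TeX l.751 and l.766–770] -/
def IsAdmissibleScale' (q : ℕ) (δ C₀ K M R : ℝ) : Prop :=
  2⁻¹ ≤ K ∧ 2⁻¹ ≤ M ∧ 2⁻¹ ≤ R ∧ R ≤ C₀ * (K * M) / (q : ℝ) ^ (7 / 3 + δ) ∧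
    K * M ≤ C₀ * (q : ℝ) ^ (17 / 6 : ℝ)

/-- **"`E(K,M,R)/KM ≪ q^{−θ}` on a range of `K`", primed interface** — verbatim copy of
`CorrSumBoundOn` over `IsAdmissibleScale'` and `IsSmoothDyadicWeight'` (quantifier order
`∀ C₀ ∀ A ∃ ε₁ ∃ C` kept). [cite: BondarenkoHeap2026, §6.2, TeX l.838–847] -/
def CorrSumBoundOn' (δ θ : ℝ) (inRange : ℕ → ℝ → Prop) : Prop :=
  ∀ C₀ : ℝ, 0 < C₀ → ∀ A : ℕ → ℝ, ∃ ε₁ : ℝ, 0 < ε₁ ∧ ∃ C : ℝ, 0 < C ∧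
    ∀ (q : ℕ) [NeZero q] (χ : DirichletCharacter ℂ q), χ.IsPrimitive → χ.IsQuadratic →
    ∀ (K M R : ℝ), IsAdmissibleScale' q δ C₀ K M R → inRange q K →
    ∀ (s : ℤ), (s = 1 ∨ s = -1) → ∀ (a b c : ℝ → ℂ),
      IsSmoothDyadicWeight' K A ((q : ℝ) ^ ε₁) a → IsSmoothDyadicWeight' M A ((q : ℝ) ^ ε₁) b →
      IsSmoothDyadicWeight' R A ((q : ℝ) ^ ε₁) c →
      ‖corrSumE χ s K M R a b c‖ ≤ C * (K * M) * (q : ℝ) ^ (-θ)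

/-- **Power saving `q^θ` for `E(K,M,R)` over `KM` on all primed-admissible scales** (copy of
`CorrSumPowerSaving`). [cite: BondarenkoHeap2026, §6.2, TeX l.838–847] -/
def CorrSumPowerSaving' (δ θ : ℝ) : Prop :=
  CorrSumBoundOn' δ θ fun _ _ => True

/-! ### The primed named facts (correction block E-ah-3; class H until re-proved) -/

/-- **(23), Range I, primed interface** (§6.3, l.864–878): for `0 < δ < 10^{−2}`, on
primed-admissible scales with `K ≤ Tq^{−1/2−η}`, `E(K,M,R)/KM ≪ q^{−η/2}`, `η = δ/10`, for weights
with loss `q^{ε₁}` per derivative. Verbatim primed copy of `rangeI_bound` (proved unprimed: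
`rangeI_bound_holds`; the printed proof uses the weight class only through `‖V‖_BV ≪ q^ε`, i.e.
`j ≤ 1`). Named fact. [claim: BondarenkoHeap2026, status: under-review] -/
def rangeI'_bound : Prop :=
  ∀ δ : ℝ, 0 < δ → δ < 1 / 100 → CorrSumBoundOn' δ (δ / 10 / 2) (InRangeI δ)

/-- **(27), Range II, primed interface** (§6.4, l.880–996): `E(K,M,R)/KM ≪ q^{−η/4}` on
`Tq^{−1/2−η} < K ≤ Tq^{−η}` for weights with loss `q^{ε₁}` per derivative. Verbatim primed copy of
`rangeII_bound` (proved unprimed: `rangeII_bound_holds`; Lemmas 7, 8 use only `|b|, |c| ≤ 1`).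
Named fact. [claim: BondarenkoHeap2026, status: under-review] -/
def rangeII'_bound : Prop :=
  ∀ δ : ℝ, 0 < δ → δ < 1 / 100 → CorrSumBoundOn' δ (δ / 10 / 4) (InRangeII δ)

/-- **(40), Range III, primed interface** (§6.5, l.998–1309): `E(K,M,R)/KM ≪ q^{−δ/2}` on
`K ≥ q^{7/3+2η}` for weights with loss `q^{ε₁}` per derivative. Verbatim primed copy of
`rangeIII_bound` (unprimed: `rangeIII_bound_of_lemma10` + `lemma10_of_prop2`; the derivative
clause enters only through Lemma 10, cf. `lemma10'`). Named fact.
[claim: BondarenkoHeap2026, status: under-review] -/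
def rangeIII'_bound : Prop :=
  ∀ δ : ℝ, 0 < δ → δ < 1 / 100 → CorrSumBoundOn' δ (δ / 2) (InRangeIII δ)

/-- **Lemma 10, primed `V`-clause** (l.1108–1123): "Let `V` be a smooth function supported in
`[1,2]` and suppose that `‖V^{(j)}‖_∞ ≪_j q^ε`. If `K ≥ q^{7/3+2η}`, then
`∑_{ψ mod q, ψ ∉ {ψ₀,χ}} |∑_n Λ(n) ψ(n) V(n/K)| ≪_{η,ε} K q^ε`" — with the hypothesis typed as
`‖V^{(j)}(x)‖ ≤ A_j (q^{ε₁})^j` (loss per derivative, as the separated weights `V(x) = ω(x)x^{−s}`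
satisfy), everything else verbatim as in `lemma10` (proved unprimed from Proposition 2:
`lemma10_of_prop2`, which uses `j ≤ 2`). Named fact. [claim: BondarenkoHeap2026, status: under-review] -/
def lemma10' : Prop :=
  ∀ η : ℝ, 0 < η → ∀ ε : ℝ, 0 < ε → ∃ ε₁ : ℝ, 0 < ε₁ ∧ ∀ A : ℕ → ℝ, ∃ C : ℝ, 0 < C ∧
    ∀ (q : ℕ) [NeZero q] (χ : DirichletCharacter ℂ q), χ.IsPrimitive → χ.IsQuadratic →
    ∀ (K : ℝ), (q : ℝ) ^ (7 / 3 + 2 * η) ≤ K →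
    ∀ (V : ℝ → ℂ), ContDiff ℝ ∞ V → (∀ x : ℝ, V x ≠ 0 → 1 ≤ x ∧ x ≤ 2) →
      (∀ (j : ℕ) (x : ℝ), ‖iteratedDeriv j V x‖ ≤ A j * ((q : ℝ) ^ ε₁) ^ j) →
      ∑ ψ ∈ (Finset.univ.filter fun ψ : DirichletCharacter ℂ q => ψ ≠ 1 ∧ ψ ≠ χ),
          ‖∑ n ∈ Icc 1 ⌊2 * K⌋₊, ((Λ n : ℝ) : ℂ) * ψ (n : ZMod q) * V ((n : ℝ) / K)‖ ≤
        C * K * (q : ℝ) ^ ε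

/-- **§6.2 reduction of `𝒪𝒟` to a power saving for `E(K,M,R)`, primed interface** (TeX
l.742–847): a power saving `q^{−θ}` for `E` over the primed weight class and primed-admissible scales
(`CorrSumPowerSaving' ρ.δ θ`) implies, for every `ε > 0`, `|𝒪𝒟| ≤ C q^ε · T · q^{−θ}` for
`q ≥ q₀`. Same conclusion as `offDiag_reduction`, hypothesis over the class the Mellin weights lie
in (so this is the WEAKER statement: `offDiag_reduction'_of_unprimed`). Named fact (Mellin analysis
not in the tree; programme: `MellinTruncatedInversion.lean`, `SmoothDyadicPartition.lean`,
`BondarenkoHeap2026OffDiagReductionProofs.lean`). [claim: BondarenkoHeap2026, status: under-review] -/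
def offDiag_reduction' : Prop :=
  ∀ (c : ℝ), 0 < c → ∀ (w : Bump) (B : ℕ) (ρ : Resonator) (θ : ℝ), 0 < θ →
    CorrSumPowerSaving' ρ.δ θ →
    ∀ ε : ℝ, 0 < ε → ∃ C : ℝ, 0 < C ∧ ∃ q₀ : ℕ,
      ∀ (q : ℕ) [NeZero q] (χ : DirichletCharacter ℂ q), q₀ ≤ q → χ.IsPrimitive → χ.IsQuadratic →
        |offDiagOD c w B ρ χ| ≤ C * (q : ℝ) ^ ε * ρ.T q * (q : ℝ) ^ (-θ)

/-! ### Proved glue: monotonicity and the comparison primed ↔ unprimed -/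

/-- Monotonicity of the primed class in the loss parameter (`0 < Q ≤ Q' ⇒ Q^j ≤ Q'^j`).
[cite: BondarenkoHeap2026, §6.2, TeX l.834–836] -/
theorem IsSmoothDyadicWeight'.mono {X : ℝ} {A : ℕ → ℝ} {Q Q' : ℝ} {a : ℝ → ℂ}
    (h : IsSmoothDyadicWeight' X A Q a) (hX : 0 < X) (hQ : 0 < Q) (hQQ' : Q ≤ Q') :
    IsSmoothDyadicWeight' X A Q' a := by
  refine ⟨h.1, h.2.1, h.2.2.1, fun j x => ?_⟩
  have hj := h.2.2.2 j x
  have hXj : 0 < X ^ j := pow_pos hX j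
  have hpow : Q ^ j ≤ Q' ^ j := pow_le_pow_left₀ hQ.le hQQ' j
  rcases le_or_gt 0 (A j) with hA | hA
  · exact hj.trans (div_le_div_of_nonneg_right (mul_le_mul_of_nonneg_left hpow hA) hXj.le)
  · exact absurd (hj.trans_lt (div_neg_of_neg_of_pos (mul_neg_of_neg_of_pos hA (pow_pos hQ j)) hXj))
      (not_lt.2 (norm_nonneg _))

/-- **Unprimed ⊆ primed** for `Q ≥ 1`, provided `A 0 ≥ 1` (at `j = 0` the primed bound is
`‖a‖ ≤ A_0`, supplied by the clause `‖a‖ ≤ 1`; for `j ≥ 1`, `Q ≤ Q^j`). This is the one place where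
priming tightens, stated explicitly. [cite: BondarenkoHeap2026, §6.2, TeX l.834–836] -/
theorem IsSmoothDyadicWeight.toPrimed {X : ℝ} {A : ℕ → ℝ} {Q : ℝ} {a : ℝ → ℂ}
    (h : IsSmoothDyadicWeight X A Q a) (hX : 0 < X) (hQ : 1 ≤ Q) (hA0 : 1 ≤ A 0) :
    IsSmoothDyadicWeight' X A Q a := by
  refine ⟨h.1, h.2.1, h.2.2.1, fun j x => ?_⟩
  rcases Nat.eq_zero_or_pos j with hj0 | hjpos
  · subst hj0
    simp only [iteratedDeriv_zero, pow_zero, mul_one, div_one]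
    exact (h.2.2.1 x).trans hA0
  · have hj := h.2.2.2 j x
    have hXj : 0 < X ^ j := pow_pos hX j
    have hQj : Q ≤ Q ^ j := le_self_pow₀ hQ (by omega)
    rcases le_or_gt 0 (A j) with hA | hA
    · exact hj.trans (div_le_div_of_nonneg_right (mul_le_mul_of_nonneg_left hQj hA) hXj.le)
    · exact absurd (hj.trans_lt (div_neg_of_neg_of_pos
        (mul_neg_of_neg_of_pos hA (by linarith)) hXj)) (not_lt.2 (norm_nonneg _))

/-- The unprimed class with family `A` lies in the primed class with family `max (A j) 1`
(`Q ≥ 1`; no condition on `A 0`). [cite: BondarenkoHeap2026, §6.2, TeX l.834–836] -/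
theorem IsSmoothDyadicWeight.toPrimed_max {X : ℝ} {A : ℕ → ℝ} {Q : ℝ} {a : ℝ → ℂ}
    (h : IsSmoothDyadicWeight X A Q a) (hX : 0 < X) (hQ : 1 ≤ Q) :
    IsSmoothDyadicWeight' X (fun j => max (A j) 1) Q a := by
  have h' : IsSmoothDyadicWeight X (fun j => max (A j) 1) Q a := by
    refine ⟨h.1, h.2.1, h.2.2.1, fun j x => (h.2.2.2 j x).trans ?_⟩
    exact div_le_div_of_nonneg_right
      (mul_le_mul_of_nonneg_right (le_max_left _ _) (by linarith)) (pow_pos hX j).le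
  exact h'.toPrimed hX hQ (le_max_right _ _)

/-- Admissible scales are primed-admissible (`1 ≤ X ⇒ 1/2 ≤ X`).
[cite: BondarenkoHeap2026, §6.2, TeX l.766–770] -/
theorem IsAdmissibleScale.toPrimed {q : ℕ} {δ C₀ K M R : ℝ} (h : IsAdmissibleScale q δ C₀ K M R) :
    IsAdmissibleScale' q δ C₀ K M R :=
  ⟨by linarith [h.1], by linarith [h.2.1], by linarith [h.2.2.1], h.2.2.2.1, h.2.2.2.2⟩

/-- **A primed range bound implies the unprimed one** (the primed class is the larger one, the
primed scales the larger set): `CorrSumBoundOn' δ θ P → CorrSumBoundOn δ θ P`, choosing the primed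
family `max (A j) 1`. So the primed facts are the STRONGER statements.
[cite: BondarenkoHeap2026, §6.2, TeX l.838–847] -/
theorem CorrSumBoundOn'.toUnprimed {δ θ : ℝ} {P : ℕ → ℝ → Prop} (h : CorrSumBoundOn' δ θ P) :
    CorrSumBoundOn δ θ P := by
  intro C₀ hC₀ A
  obtain ⟨ε₁, hε₁, C, hC, H⟩ := h C₀ hC₀ (fun j => max (A j) 1)
  refine ⟨ε₁, hε₁, C, hC, ?_⟩
  intro q _ χ hχp hχq K M R hadm hP s hs a b c ha hb hc
  have hq1 : (1 : ℝ) ≤ q := by exact_mod_cast NeZero.one_le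
  have hQ : (1 : ℝ) ≤ (q : ℝ) ^ ε₁ := Real.one_le_rpow hq1 hε₁.le
  have hK : 0 < K := by linarith [hadm.1]
  have hM : 0 < M := by linarith [hadm.2.1]
  have hR : 0 < R := by linarith [hadm.2.2.1]
  exact H q χ hχp hχq K M R hadm.toPrimed hP s hs a b c (ha.toPrimed_max hK hQ)
    (hb.toPrimed_max hM hQ) (hc.toPrimed_max hR hQ)

/-- `rangeI'_bound → rangeI_bound`. [cite: BondarenkoHeap2026, eq. (23), TeX l.873] -/
theorem rangeI_bound_of_primed (h : rangeI'_bound) : rangeI_bound :=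
  fun δ hδ hδ' => (h δ hδ hδ').toUnprimed

/-- `rangeII'_bound → rangeII_bound`. [cite: BondarenkoHeap2026, eq. (27), TeX l.991] -/
theorem rangeII_bound_of_primed (h : rangeII'_bound) : rangeII_bound :=
  fun δ hδ hδ' => (h δ hδ hδ').toUnprimed

/-- `rangeIII'_bound → rangeIII_bound`. [cite: BondarenkoHeap2026, eq. (40), TeX l.1304] -/
theorem rangeIII_bound_of_primed (h : rangeIII'_bound) : rangeIII_bound :=
  fun δ hδ hδ' => (h δ hδ hδ').toUnprimed

/-- `CorrSumPowerSaving' δ θ → CorrSumPowerSaving δ θ`. [cite: BondarenkoHeap2026, §6.2, TeX l.838–847] -/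
theorem CorrSumPowerSaving'.toUnprimed {δ θ : ℝ} (h : CorrSumPowerSaving' δ θ) :
    CorrSumPowerSaving δ θ :=
  CorrSumBoundOn'.toUnprimed h

/-- **The primed reduction is the weaker statement**: `offDiag_reduction → offDiag_reduction'`
(its hypothesis `CorrSumPowerSaving'` implies `CorrSumPowerSaving`).
[cite: BondarenkoHeap2026, §6.2, TeX l.838–847] -/
theorem offDiag_reduction'_of_unprimed (h : offDiag_reduction) : offDiag_reduction' :=
  fun c hc w B ρ θ hθ hPS => h c hc w B ρ θ hθ hPS.toUnprimed

/-! ### Proved glue: the three primed ranges give a primed power saving, and Proposition 6 -/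

/-- **"Combining the power savings from all three ranges"** (l.1309), primed interface: for
`0 < δ < 10^{−2}`, `rangeI'_bound ∧ rangeII'_bound ∧ rangeIII'_bound` give
`|E(K,M,R)| ≤ C · KM · q^{−δ/40}` on every primed-admissible scale (textual copy of
`corrSumPowerSaving_of_ranges`). [cite: BondarenkoHeap2026, §6.5, TeX l.1309] -/
theorem corrSumPowerSaving'_of_ranges' (h₁ : rangeI'_bound) (h₂ : rangeII'_bound)
    (h₃ : rangeIII'_bound) {δ : ℝ} (hδ : 0 < δ) (hδ' : δ < 1 / 100) :
    CorrSumPowerSaving' δ (δ / 40) := by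
  intro C₀ hC₀ A
  obtain ⟨e₁, he₁, C₁, hC₁, H₁⟩ := h₁ δ hδ hδ' C₀ hC₀ A
  obtain ⟨e₂, he₂, C₂, hC₂, H₂⟩ := h₂ δ hδ hδ' C₀ hC₀ A
  obtain ⟨e₃, he₃, C₃, hC₃, H₃⟩ := h₃ δ hδ hδ' C₀ hC₀ A
  refine ⟨min e₁ (min e₂ e₃), lt_min he₁ (lt_min he₂ he₃), C₁ + C₂ + C₃, by positivity, ?_⟩
  intro q _ χ hχp hχq K M R hadm _ s hs a b c ha hb hc
  have hq1 : (1 : ℝ) ≤ q := by exact_mod_cast NeZero.one_le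
  have hK : 0 < K := by linarith [hadm.1]
  have hM : 0 < M := by linarith [hadm.2.1]
  have hR : 0 < R := by linarith [hadm.2.2.1]
  have hpow : ∀ e : ℝ, min e₁ (min e₂ e₃) ≤ e →
      (0 : ℝ) < (q : ℝ) ^ min e₁ (min e₂ e₃) ∧ (q : ℝ) ^ min e₁ (min e₂ e₃) ≤ (q : ℝ) ^ e :=
    fun e he => ⟨by positivity, Real.rpow_le_rpow_of_exponent_le hq1 he⟩
  have hw : ∀ (e : ℝ), min e₁ (min e₂ e₃) ≤ e → ∀ {X : ℝ} {w : ℝ → ℂ}, 0 < X →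
      IsSmoothDyadicWeight' X A ((q : ℝ) ^ min e₁ (min e₂ e₃)) w →
      IsSmoothDyadicWeight' X A ((q : ℝ) ^ e) w :=
    fun e he X w hX h => h.mono hX (hpow e he).1 (hpow e he).2
  have hexp : ∀ θ : ℝ, δ / 40 ≤ θ → (q : ℝ) ^ (-θ) ≤ (q : ℝ) ^ (-(δ / 40)) :=
    fun θ hθ => Real.rpow_le_rpow_of_exponent_le hq1 (by linarith)
  have hfin : ∀ (Cᵢ θ : ℝ), 0 < Cᵢ → Cᵢ ≤ C₁ + C₂ + C₃ → δ / 40 ≤ θ →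
      ‖corrSumE χ s K M R a b c‖ ≤ Cᵢ * (K * M) * (q : ℝ) ^ (-θ) →
      ‖corrSumE χ s K M R a b c‖ ≤ (C₁ + C₂ + C₃) * (K * M) * (q : ℝ) ^ (-(δ / 40)) := by
    intro Cᵢ θ hCᵢ hle hθ h
    refine h.trans ?_
    have h0 : (0 : ℝ) ≤ (q : ℝ) ^ (-θ) := by positivity
    calc Cᵢ * (K * M) * (q : ℝ) ^ (-θ) ≤ (C₁ + C₂ + C₃) * (K * M) * (q : ℝ) ^ (-θ) := by
          gcongr
      _ ≤ (C₁ + C₂ + C₃) * (K * M) * (q : ℝ) ^ (-(δ / 40)) :=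
          mul_le_mul_of_nonneg_left (hexp θ hθ) (by positivity)
  rcases inRange_cases hδ (NeZero.one_le : 1 ≤ q) K with hI | hII | hIII
  · have he : min e₁ (min e₂ e₃) ≤ e₁ := min_le_left _ _
    exact hfin C₁ (δ / 10 / 2) hC₁ (by linarith) (by linarith)
      (H₁ q χ hχp hχq K M R hadm hI s hs a b c (hw e₁ he hK ha) (hw e₁ he hM hb) (hw e₁ he hR hc))
  · have he : min e₁ (min e₂ e₃) ≤ e₂ := (min_le_right _ _).trans (min_le_left _ _)
    exact hfin C₂ (δ / 10 / 4) hC₂ (by linarith) (by linarith)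
      (H₂ q χ hχp hχq K M R hadm hII s hs a b c (hw e₂ he hK ha) (hw e₂ he hM hb) (hw e₂ he hR hc))
  · have he : min e₁ (min e₂ e₃) ≤ e₃ := (min_le_right _ _).trans (min_le_right _ _)
    exact hfin C₃ (δ / 2) hC₃ (by linarith) (by linarith)
      (H₃ q χ hχp hχq K M R hadm hIII s hs a b c (hw e₃ he hK ha) (hw e₃ he hM hb) (hw e₃ he hR hc))

/-- **Proposition 6 from the primed reduction and the three primed ranges** (textual copy of
`prop6_of_reduction_of_ranges`: saving `q^{−δ/40}`, `ε = δ/80`, `φ(q)/q > δ₀/log log q`).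
[cite: BondarenkoHeap2026, Proposition 6 and §6.5, TeX l.644–648, l.845, l.1309] -/
theorem prop6_of_reduction'_of_ranges' (hred : offDiag_reduction') (h₁ : rangeI'_bound)
    (h₂ : rangeII'_bound) (h₃ : rangeIII'_bound) : prop6 := by
  intro c hc w B ρ η hη
  have hδ := ρ.δ_pos
  have hδ' := ρ.δ_lt
  have hPS : CorrSumPowerSaving' ρ.δ (ρ.δ / 40) := corrSumPowerSaving'_of_ranges' h₁ h₂ h₃ hδ hδ'
  obtain ⟨C, hC, q₀, H⟩ :=
    hred c hc w B ρ (ρ.δ / 40) (by positivity) hPS (ρ.δ / 80) (by positivity)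
  obtain ⟨δ₀, hδ₀, Hφ⟩ := MertensBound.exists_lt_totient_div_self
  set X : ℝ := (C / (η * δ₀)) ^ (80 / ρ.δ) with hX
  refine ⟨q₀ + 3 + ⌈X⌉₊, ?_⟩
  intro q _ χ hq hχp hχq
  have hq₀ : q₀ ≤ q := by omega
  have hq3 : (3 : ℕ) ≤ q := by omega
  have hqX : X ≤ q := by
    have h1 : X ≤ ⌈X⌉₊ := Nat.le_ceil X
    have h2 : (⌈X⌉₊ : ℝ) ≤ q := by exact_mod_cast (by omega : ⌈X⌉₊ ≤ q)
    exact h1.trans h2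
  have hq1 : (1 : ℝ) < q := by exact_mod_cast (by omega : 1 < q)
  have hq0 : (0 : ℝ) < q := by positivity
  have hT0 : 0 < ρ.T q := by unfold Resonator.T; positivity
  have hmain := H q χ hq₀ hχp hχq
  have hCX : 0 < C / (η * δ₀) := by positivity
  have hpow : C * (q : ℝ) ^ (-(ρ.δ / 80)) ≤ η * δ₀ := by
    have h1 : C / (η * δ₀) ≤ (q : ℝ) ^ (ρ.δ / 80) := by
      have h2 : X ^ (ρ.δ / 80) ≤ (q : ℝ) ^ (ρ.δ / 80) :=
        Real.rpow_le_rpow (by positivity) hqX (by positivity)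
      have h3 : X ^ (ρ.δ / 80) = C / (η * δ₀) := by
        rw [hX, ← Real.rpow_mul hCX.le, show (80 / ρ.δ) * (ρ.δ / 80) = 1 by field_simp,
          Real.rpow_one]
      rw [← h3]; exact h2
    have h4 : C ≤ η * δ₀ * (q : ℝ) ^ (ρ.δ / 80) := by
      rw [div_le_iff₀ (by positivity)] at h1; linarith
    have h5 : (q : ℝ) ^ (ρ.δ / 80) * (q : ℝ) ^ (-(ρ.δ / 80)) = 1 := by
      rw [← Real.rpow_add hq0, add_neg_cancel, Real.rpow_zero]
    calc C * (q : ℝ) ^ (-(ρ.δ / 80))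
        ≤ (η * δ₀ * (q : ℝ) ^ (ρ.δ / 80)) * (q : ℝ) ^ (-(ρ.δ / 80)) :=
          mul_le_mul_of_nonneg_right h4 (by positivity)
      _ = η * δ₀ := by rw [mul_assoc, h5, mul_one]
  have hφ := Hφ q hq3
  have hq3r : (3 : ℝ) ≤ q := by exact_mod_cast hq3
  have hlogq : 1 < Real.log q := by
    have h := Real.log_le_log (by norm_num) hq3r
    have h3 : 1 < Real.log 3 := by
      exact (Real.lt_log_iff_exp_lt (by norm_num)).mpr (by
        have := Real.exp_one_lt_d9; linarith)
    linarith
  have hll0 : 0 < Real.log (Real.log q) := Real.log_pos hlogq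
  have hllq : Real.log (Real.log q) ≤ Real.log q :=
    (Real.log_le_sub_one_of_pos (by linarith)).trans (by linarith)
  have hlogT : Real.log q ≤ Real.log (ρ.T q) := by
    unfold Resonator.T
    rw [Real.log_rpow hq0]
    have : 0 ≤ Real.log q := by linarith
    nlinarith
  have hφq0 : 0 ≤ (Nat.totient q : ℝ) / q := by positivity
  have hδ₀le : δ₀ ≤ (Nat.totient q : ℝ) / q * Real.log (ρ.T q) := by
    have h1 : δ₀ < (Nat.totient q : ℝ) / q * Real.log (Real.log q) := by
      rw [div_lt_iff₀ hll0] at hφ; linarith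
    have h2 : (Nat.totient q : ℝ) / q * Real.log (Real.log q) ≤
        (Nat.totient q : ℝ) / q * Real.log (ρ.T q) :=
      mul_le_mul_of_nonneg_left (hllq.trans hlogT) hφq0
    linarith
  have hexp : (q : ℝ) ^ (ρ.δ / 80) * (q : ℝ) ^ (-(ρ.δ / 40)) = (q : ℝ) ^ (-(ρ.δ / 80)) := by
    rw [← Real.rpow_add hq0]
    exact congrArg (fun t : ℝ => (q : ℝ) ^ t) (by ring)
  calc |offDiagOD c w B ρ χ|
      ≤ C * (q : ℝ) ^ (ρ.δ / 80) * ρ.T q * (q : ℝ) ^ (-(ρ.δ / 40)) := hmain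
    _ = ρ.T q * (C * ((q : ℝ) ^ (ρ.δ / 80) * (q : ℝ) ^ (-(ρ.δ / 40)))) := by ring
    _ = ρ.T q * (C * (q : ℝ) ^ (-(ρ.δ / 80))) := by rw [hexp]
    _ ≤ ρ.T q * (η * δ₀) := mul_le_mul_of_nonneg_left hpow hT0.le
    _ ≤ ρ.T q * (η * ((Nat.totient q : ℝ) / q * Real.log (ρ.T q))) :=
        mul_le_mul_of_nonneg_left (mul_le_mul_of_nonneg_left hδ₀le hη.le) hT0.le
    _ = η * (ρ.T q * ((Nat.totient q : ℝ) / q) * Real.log (ρ.T q)) := by ring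

end Literature.NumberTheory.LFunctions.BondarenkoHeap2026

end
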